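import Summits.HodgeConjecture.HodgeConjecture.Theorems.CYFormCasimirCYFormCarrierEightAntiInvolution
import Summits.HodgeConjecture.HodgeConjecture.Theorems.CYFormCasimirCYFormSquarePrincipleGraph
import HarnessLib

/-!
# Crux X1 `CYFormCarrierEight` (route `CYFormCasimir`, stmt-HodgeConjecture-23493), helper file 7:
# `⋀⁴W` and `⋀⁴W^*` are sub-Hodge structures — pure-type span and stability under the type projectors

research route conditional on HC_CM; not a corollary. Nothing here proves HC, HC_CM, the rung H2, X1 or `stub_cyform_exists`;
step S3 (types) of `Cruxes/CYFormCarrierEight/STUB-PLAN-stub_cyform_exists.md`.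

* `typeProj_mem_weilClassesPlus_two`, `typeProj_mem_weilClassesMinus_two` — for an eightfold, `⋀⁴W` and `⋀⁴W^*` are
  stable under the Hodge type projectors of any Hodge model (`E± = ⊕_{p+q=4} E±^{p,q}`; X3's `typeProj_mem_of_mem`).

References: VoisinHodgeI2002 (§7.1.1–7.1.2), vanGeemen1994HodgeAV (proof of Lemma 5.2, Thm. 6.12).
-/

-- `Summit.HodgeConjecture.HodgeConjecture.…` is the tree's mandated summit/problem namespace (single-problem summit).
set_option linter.dupNamespace false
noncomputable section

open CategoryTheory
open Literature.AlgebraicTopology.SingularHomology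
open Literature.AlgebraicGeometry.Motives
open Literature.AlgebraicGeometry.HodgeTheory

namespace Summit.HodgeConjecture.HodgeConjecture.Theorems.CYFormCarrier

section TypePieces

variable {A : AbelianVariety ℂ} {d : ℕ} {φ : A ⟶ A}

/-- **`⋀⁴W` is stable under the Hodge type projectors** of any Hodge model of the eightfold `A`
(`⋀⁴W = ⊕_{p+q=4} (⋀⁴W)^{p,q}`): `W = W∩H^{1,0} ⊕ W∩H^{0,1}` (`eigenspace_eq_sup`), so `⋀⁴W` is spanned by wedges of
pure degree-one classes, which have pure type (`isOfHodgeType_cupPowOne`) — the `W`-companion of helper file 1's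
`weilClassesMinus_le_span_pureType` — and a pure-type-spanned subspace is stable under the type projectors
(X3's `typeProj_mem_of_mem`). [cite: VoisinHodgeI2002, §7.1.1–7.1.2] [cite: vanGeemen1994HodgeAV, proof of Lemma 5.2] -/
theorem typeProj_mem_weilClassesPlus_two (hd : 0 < d) (hA : A.dim = 2 * 4) (hφ : φ ≫ φ = -(d • 𝟙 A))
    (M : HodgeModel (2 * 4) A.X) (pq : ↥(Finset.HasAntidiagonal.antidiagonal (2 * 2)))
    {t : complexBetti A.X (2 * 2)} (ht : t ∈ weilClassesPlus A φ 2 d) :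
    M.typeProj (2 * 2) pq t ∈ weilClassesPlus A φ 2 d := by
  have hX : IsSmoothProjective (2 * 4) A.X := isSmoothProjective_of_dim_eq' hA
  have hspan : ∀ {m : ℕ} (hX : IsSmoothProjective m A.X) {n : ℕ} (hn : 0 < n),
      weilClassesPlus A φ n d ≤ Submodule.span ℂ {c | c ∈ weilClassesPlus A φ n d ∧
        ∃ p q : ℕ, p + q = 2 * n ∧ IsOfHodgeType m A.X (2 * n) p q c} := by
    intro m hX n hn
    classical
    set V := Module.End.eigenspace (complexBetti.map φ.hom.hom.hom 1).hom (Complex.I * (Real.sqrt d : ℂ))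
      with hV
    -- pure-type vectors span `V = W`
    set P : Set V := {v | (v : complexBetti A.X 1) ∈ hodgeOneZero hX ∨
      (v : complexBetti A.X 1) ∈ hodgeZeroOne hX} with hP
    have hPspan : Submodule.span ℂ P = ⊤ := by
      refine eq_top_iff.2 fun v _ => ?_
      have hv : (v : complexBetti A.X 1) ∈ V ⊓ hodgeOneZero hX ⊔ V ⊓ hodgeZeroOne hX := by
        rw [← eigenspace_eq_sup hX φ.hom.hom.hom]; exact v.2
      obtain ⟨a, ha, b, hb, hab⟩ := Submodule.mem_sup.1 hv
      have hv' : v = ⟨a, ha.1⟩ + ⟨b, hb.1⟩ := Subtype.ext hab.symm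
      rw [hv']
      exact Submodule.add_mem _ (Submodule.subset_span (Or.inl ha.2)) (Submodule.subset_span (Or.inr hb.2))
    have hE : weilClassesPlus A φ n d = Submodule.span ℂ
        ((wedgeToCup ℂ (ComplexPoints A.X) (2 * n)) '' ((exteriorPower.map (2 * n) V.subtype) ''
          (exteriorPower.ιMulti ℂ (2 * n) '' {a : Fin (2 * n) → V | Set.range a ⊆ P}))) := by
      rw [weilClassesPlus_eq_map_range hd hφ n, LinearMap.range_eq_map, ← hV,
        ← exteriorPower.ιMulti_span_of_span ℂ (2 * n) V hPspan, Submodule.map_span, Submodule.map_span]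
    conv_lhs => rw [hE]
    rw [Submodule.span_le]
    rintro _ ⟨_, ⟨_, ⟨a, ha, rfl⟩, rfl⟩, rfl⟩
    refine Submodule.subset_span ⟨?_, ?_⟩
    · rw [hE]
      exact Submodule.subset_span ⟨_, ⟨_, ⟨a, ha, rfl⟩, rfl⟩, rfl⟩
    · rw [exteriorPower.map_apply_ιMulti, wedgeToCup_ιMulti]
      let p : Fin (2 * n) → ℕ := fun i => if (a i : complexBetti A.X 1) ∈ hodgeOneZero hX then 1 else 0
      let q : Fin (2 * n) → ℕ := fun i => if (a i : complexBetti A.X 1) ∈ hodgeOneZero hX then 0 else 1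
      have hw : ∀ i, IsOfHodgeType m A.X 1 (p i) (q i) ((⇑V.subtype ∘ a) i) := by
        intro i
        by_cases hi : (a i : complexBetti A.X 1) ∈ hodgeOneZero hX
        · simp only [p, q, if_pos hi]; exact hi
        · simp only [p, q, if_neg hi]; exact (ha ⟨i, rfl⟩).resolve_left hi
      have hpq : ∀ i, p i + q i = 1 := fun i => by
        by_cases hi : (a i : complexBetti A.X 1) ∈ hodgeOneZero hX
        · simp only [p, q, if_pos hi]
        · simp only [p, q, if_neg hi]
      refine ⟨∑ i, p i, ∑ i, q i, ?_, isOfHodgeType_cupPowOne hX (by omega) _ p q hw⟩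
      rw [← Finset.sum_add_distrib, Finset.sum_congr rfl fun i _ => hpq i, Finset.sum_const, Finset.card_univ,
        Fintype.card_fin, smul_eq_mul, mul_one]
  exact CYFormSquare.typeProj_mem_of_mem hA M (hspan hX two_pos) pq ht

/-- **`⋀⁴W^*` is stable under the Hodge type projectors** of any Hodge model of the eightfold `A`
(`⋀⁴W^* = ⊕_{p+q=4} (⋀⁴W^*)^{p,q}`). [cite: VoisinHodgeI2002, §7.1.1] -/
theorem typeProj_mem_weilClassesMinus_two (hd : 0 < d) (hA : A.dim = 2 * 4) (hφ : φ ≫ φ = -(d • 𝟙 A))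
    (M : HodgeModel (2 * 4) A.X) (pq : ↥(Finset.HasAntidiagonal.antidiagonal (2 * 2)))
    {t : complexBetti A.X (2 * 2)} (ht : t ∈ weilClassesMinus A φ 2 d) :
    M.typeProj (2 * 2) pq t ∈ weilClassesMinus A φ 2 d :=
  CYFormSquare.typeProj_mem_of_mem hA M
    (weilClassesMinus_le_span_pureType hd hφ (isSmoothProjective_of_dim_eq' hA) two_pos) pq ht

end TypePieces

end Summit.HodgeConjecture.HodgeConjecture.Theorems.CYFormCarrier

end
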